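/-
COR-CM (cell pub-hodgecm2, stage 2 of the Hodge ladder) — count-neutral kernel census (seat prover-pub-hodgecm2-b23-g37-0, binder
prover b23, gen 37; claim EVEN-SLICE F1, HOME/INBOX.md 2026-08-22T13:48Z; sequel of the seat's ODD-SLICE-TRANSPORT and of seat b09's
ODD-SLICE-FACES).  Theorems only, in seat b09's representative-free model of the faithful full slice of `(ℤ/2 × A, (1,0))`
(`Census/OddSliceFacesModel|Squares|Descent.lean`, consumed BY NAME; nothing of b09's is restated or re-filed); no definition, no
`decide` table, no certificate, no named fact, no geometry, no `sorry`.  `Interfaces.lean` (C1), every E term, B01 and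
`Transposition/*` are untouched.  HC_CM is NOT proved anywhere in this cell; nothing here is a headline and nothing here produces a
period.
-/
import Summits.HodgeConjecture.CorCM.Census.OddSliceFacesDescent

/-!
# Faces generate the Hodge lattice of the faithful full slice — the PARITY-FREE descent: by defect class, for every finite abelian `A`

Seat b09's part III (`Census/OddSliceFacesDescent.lean`) descends an exponent vector by NORMALISED WEIGHT, which needs `|A|` odd
(exactly one of `ψ`, `ψ + 1` has weight `≤ |A|/2`).  This file descends by DEFECT CLASS `clsTy ψ = min (wt ψ, |A| − wt ψ)` instead,
which needs nothing: for a label `ψ` of class `k ≥ 2`, `ψ = tw g (rep ω)` for SOME `g ∈ ℤ/2 × A` (`exists_tw_rep_eq`, no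
normalisation), and the `g`-translate of the canonical square of `ω` is a face class `e_ψ + e_{c₂} + e_{c₃} + e_{c₄}` whose three
other corners have class `≤ k − 1` in BOTH cases `g.1 = 0` (the square through two defects of `ψ`: corner weights `|A| − k + 1`,
`|A| − k + 1`, `k − 2`) and `g.1 = 1` (the complement-shift of the square through two defects of `ψ + 1`: corner weights `k − 1`,
`k − 1`, `|A| − k + 2`) — `exists_square_through_cls`.  Hence:

* `clear_step_cls` / `descent_cls`: a vector supported in class `≤ K` is congruent, modulo the translates of the canonical squares OF
  CLASS `≤ K` ONLY (`(squares A).filter (wt ·.1 ≤ K)` — the main corner of `sqFace ω` has weight `cls ω`), to a vector supported in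
  class `≤ 1`; no pairs are used;
* `exists_reduced_cls` / **`exists_reduced`** (b09's statement WITHOUT `Odd (Fintype.card A)`): modulo `pairs ⊔ spanFaces squares`
  every vector is supported on the labels of weight `≤ 1` (fold the heavy labels of class `≤ 1` onto their conjugates);
* **`hodge_le_pairs_sup_spanFaces_squares_sup_span_weil`**: for EVERY finite abelian group `A`, modulo the pairs and the translates of
  the canonical squares the Hodge lattice is cyclic, generated by the Weil vector `weil = Σ_s e_{δ s} − (|A| − 2)·e_0` (b09's key lemma
  `eq_smul_weil_of_wt_le_one` is parity-free).  What remains, `weil ∈ pairs ⊔ spanFaces (…)`, is where parity enters: for `|A|` odd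
  b09 adjoins ONE closing face (`OddSliceFacesGenerate`); for `|A|` even NO face is needed (the seat's part F2,
  `Census/EvenSliceFacesGenerate.lean`).

All [folklore].

## References
* [Pohlmann1968] H. Pohlmann, Algebraic cycles on abelian varieties of complex multiplication type, Ann. of Math. 88 (1968), Thm 1.
* [Milne1999] J. S. Milne, Lefschetz motives and the Tate conjecture, Compositio Math. 117 (1999), Prop. 2.1, p. 54.
-/

namespace Summit.HodgeConjecture.CorCM.Census.EvenSliceFacesDescent

open Finset
open Summit.HodgeConjecture.CorCM.Census.OddSliceFacesModel
open Summit.HodgeConjecture.CorCM.Census.OddSliceFacesSquares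
open Summit.HodgeConjecture.CorCM.Census.OddSliceFacesDescent

variable (A : Type) [AddCommGroup A] [Fintype A] [DecidableEq A]

/-! ## §1 Every nonconstant type is a twist of the representative of its simple factor; defect classes of corners -/

omit [DecidableEq A] in
/-- **Every nonconstant type is a twist of the normalised representative of its simple factor** — by SOME `g ∈ ℤ/2 × A`; no parity,
no normalisation. [folklore] -/
theorem exists_tw_rep_eq (ψ : OddDegreeParityLaw.Nonconst A) :
    ∃ g : ZMod 2 × A, tw A g (rep A (Quotient.mk _ ψ : OddDegreeParityLaw.OrbitsA A)) = ψ.1 := by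
  set ω : OddDegreeParityLaw.OrbitsA A := Quotient.mk _ ψ with hω
  obtain ⟨g₁, hg₁⟩ := exists_tw_of_mk_eq A (Quotient.out_eq ω)
  obtain ⟨g₂, hg₂⟩ := exists_tw_out_eq_rep A ω
  refine ⟨-(g₁ + g₂), ?_⟩
  rw [← hg₂, ← hg₁, tw_tw, tw_tw]
  have h0 : g₁ + (g₂ + -(g₁ + g₂)) = 0 := by abel
  rw [h0, tw_zero]

omit [AddCommGroup A] [DecidableEq A] in
/-- The defect class is at most the weight. [folklore] -/
theorem clsTy_le_wt (χ : Ty A) : clsTy A χ ≤ wt A χ := min_le_left _ _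

omit [DecidableEq A] in
/-- The defect class is invariant under conjugation. [folklore] -/
theorem clsTy_add_one (χ : Ty A) : clsTy A (χ + 1) = clsTy A χ := by
  rw [← tw_one_zero, clsTy_tw]

omit [DecidableEq A] in
/-- A type of defect class `≥ 2` is nonconstant. [folklore] -/
theorem nonconst_of_two_le_clsTy {ψ : Ty A} (h : 2 ≤ clsTy A ψ) : ¬ ∀ y, ψ y = ψ 0 := by
  unfold clsTy at h
  have := wt_le A ψ
  exact nonconst_of_wt A (by omega) (by omega)

omit [AddCommGroup A] in
/-- Removing a defect lowers the weight by one: `wt (φ + δ i) = wt φ − 1` for `φ i = 1`. [folklore] -/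
theorem wt_add_delta_of_apply_eq_one {φ : Ty A} {i : A} (hi : φ i = 1) : wt A (φ + δ A i) = wt A φ - 1 := by
  set Q := univ.filter fun s => φ s = 1 with hQ
  have hφ : φ = ind A Q := (ind_filter A φ).symm
  have hiQ : i ∈ Q := by rw [hQ]; simp [hi]
  rw [hφ, ind_add_delta A hiQ, wt_ind, wt_ind, Finset.card_erase_of_mem hiQ]

omit [AddCommGroup A] in
/-- **Class of the conjugate corner** `φ̄^{(i)} = φ + 1 + δ i` through a defect: at most `wt φ − 1` (its weight is `|A| − wt φ + 1`).
[folklore] -/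
theorem clsTy_corner_bar_le {φ : Ty A} {i : A} (hi : φ i = 1) : clsTy A (φ + 1 + δ A i) ≤ wt A φ - 1 := by
  unfold clsTy
  rw [wt_corner_bar A hi]
  have := wt_le A φ
  omega

omit [AddCommGroup A] in
/-- **Class of the flipped corner** `φ^{(ij)} = φ + δ i + δ j` through two defects: at most `wt φ − 1` (its weight is `wt φ − 2`).
[folklore] -/
theorem clsTy_corner_flip_le {φ : Ty A} {i j : A} (hi : φ i = 1) (hj : φ j = 1) (hij : i ≠ j) :
    clsTy A (φ + δ A i + δ A j) ≤ wt A φ - 1 := by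
  refine (clsTy_le_wt A _).trans ?_
  rw [wt_corner_flip A hi hj hij]
  omega

omit [AddCommGroup A] in
/-- Class of the light corner `φ + δ i` (a defect removed): at most `wt φ − 1`. [folklore] -/
theorem clsTy_add_delta_le {φ : Ty A} {i : A} (hi : φ i = 1) : clsTy A (φ + δ A i) ≤ wt A φ - 1 := by
  refine (clsTy_le_wt A _).trans ?_
  rw [wt_add_delta_of_apply_eq_one A hi]

/-! ## §2 A translated canonical square through every label of class `≥ 2`, with the other corners of smaller class -/

/-- **Every label `ψ` of defect class `k ≥ 2` is the main corner of a translated canonical square of class `k` whose other three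
corners have class `≤ k − 1`.**  The square is a member of `spanFaces` of the canonical squares of main-corner weight `≤ K` for any
`K ≥ k`. [folklore] -/
theorem exists_square_through_cls {K : ℕ} {ψ : Ty A} (h2 : 2 ≤ clsTy A ψ) (hK : clsTy A ψ ≤ K) :
    ∃ v ∈ spanFaces A ((squares A).filter fun f => wt A f.1 ≤ K), ∃ c₂ c₃ c₄ : Ty A,
      clsTy A c₂ ≤ clsTy A ψ - 1 ∧ clsTy A c₃ ≤ clsTy A ψ - 1 ∧ clsTy A c₄ ≤ clsTy A ψ - 1 ∧
      v = Pi.single ψ 1 + Pi.single c₂ 1 + Pi.single c₃ 1 + Pi.single c₄ 1 := by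
  have hnc : ¬ ∀ y, ψ y = ψ 0 := nonconst_of_two_le_clsTy A h2
  set ω : OddDegreeParityLaw.OrbitsA A := Quotient.mk _ (⟨ψ, hnc⟩ : OddDegreeParityLaw.Nonconst A) with hω
  have hcls : cls A ω = clsTy A ψ := by rw [hω, cls_mk]
  have hwt : wt A (rep A ω) = clsTy A ψ := by rw [wt_rep, hcls]
  have hrep2 : 2 ≤ wt A (rep A ω) := by rw [hwt]; exact h2
  obtain ⟨hij, hi, hj⟩ := pick_spec A hrep2
  set i₀ := (pick A (rep A ω)).1 with hi₀
  set j₀ := (pick A (rep A ω)).2 with hj₀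
  obtain ⟨g, hg⟩ := exists_tw_rep_eq A ⟨ψ, hnc⟩
  have hg' : tw A g (rep A ω) = ψ := hg
  -- the translated square
  have hmem : transl A g (faceVec A (rep A ω) i₀ j₀) ∈ spanFaces A ((squares A).filter fun f => wt A f.1 ≤ K) := by
    refine Submodule.subset_span ⟨g, sqFace A ω, ?_, rfl⟩
    refine Finset.mem_filter.mpr ⟨?_, ?_⟩
    · exact Finset.mem_image.mpr ⟨ω, Finset.mem_filter.mpr ⟨Finset.mem_univ _, by rw [hcls]; exact h2⟩, rfl⟩
    · show wt A (rep A ω) ≤ K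
      rw [hwt]; exact hK
  rw [transl_faceVec] at hmem
  obtain ⟨a, t⟩ := g
  have hij' : i₀ - t ≠ j₀ - t := fun h => hij (sub_left_injective h)
  -- the `(0,t)`-twist `ψ'` of the representative: weight `k`, defects at `i₀ − t`, `j₀ − t`
  set ψ' : Ty A := tw A (0, t) (rep A ω) with hψ'
  have hwt' : wt A ψ' = clsTy A ψ := by rw [hψ', wt_tw_zero, hwt]
  have hi' : ψ' (i₀ - t) = 1 := by simp only [hψ', tw, sub_add_cancel, add_zero]; exact hi
  have hj' : ψ' (j₀ - t) = 1 := by simp only [hψ', tw, sub_add_cancel, add_zero]; exact hj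
  have h01 : ∀ u : ZMod 2, u = 0 ∨ u = 1 := by decide
  rcases h01 a with rfl | rfl
  · -- `ψ = ψ'`: the square through two defects of `ψ`
    have hψ : ψ = ψ' := hg'.symm
    refine ⟨_, hmem, ψ' + 1 + δ A (i₀ - t), ψ' + 1 + δ A (j₀ - t), ψ' + δ A (i₀ - t) + δ A (j₀ - t), ?_, ?_, ?_, ?_⟩
    · rw [← hwt']; exact clsTy_corner_bar_le A hi'
    · rw [← hwt']; exact clsTy_corner_bar_le A hj'
    · rw [← hwt']; exact clsTy_corner_flip_le A hi' hj' hij'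
    · show faceVec A (tw A (0, t) (rep A ω)) (i₀ - t) (j₀ - t) = _
      rw [← hψ', hψ]
      rfl
  · -- `ψ = ψ' + 1`: the complement-shift of the square through two defects of `ψ'`
    have hψ : ψ = ψ' + 1 := by rw [← hg', hψ', tw_one]
    refine ⟨_, hmem, ψ' + δ A (i₀ - t), ψ' + δ A (j₀ - t), ψ' + δ A (i₀ - t) + δ A (j₀ - t) + 1, ?_, ?_, ?_, ?_⟩
    · rw [← hwt']; exact clsTy_add_delta_le A hi'
    · rw [← hwt']; exact clsTy_add_delta_le A hj'
    · rw [clsTy_add_one, ← hwt']; exact clsTy_corner_flip_le A hi' hj' hij'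
    · show faceVec A (tw A (1, t) (rep A ω)) (i₀ - t) (j₀ - t) = _
      rw [tw_one, ← hψ']
      have e2 : ψ' + 1 + 1 + δ A (i₀ - t) = ψ' + δ A (i₀ - t) := by rw [add_one_add_one]
      have e3 : ψ' + 1 + 1 + δ A (j₀ - t) = ψ' + δ A (j₀ - t) := by rw [add_one_add_one]
      have e4 : ψ' + 1 + δ A (i₀ - t) + δ A (j₀ - t) = ψ' + δ A (i₀ - t) + δ A (j₀ - t) + 1 := by abel
      unfold faceVec
      rw [e2, e3, e4, ← hψ]

/-! ## §3 Clearing by defect class and the descent (no pairs needed) -/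

/-- **Clearing step.**  A vector supported in class `≤ k`, `2 ≤ k ≤ K`, is congruent modulo the translates of the canonical squares of
weight `≤ K` to a vector supported in class `≤ k − 1`. [folklore] -/
theorem clear_step_cls {K k : ℕ} (hk2 : 2 ≤ k) (hkK : k ≤ K) (m : Ty A → ℤ) (hm : ∀ χ, m χ ≠ 0 → clsTy A χ ≤ k) :
    ∃ m' : Ty A → ℤ, (∀ χ, m' χ ≠ 0 → clsTy A χ ≤ k - 1) ∧
      m - m' ∈ spanFaces A ((squares A).filter fun f => wt A f.1 ≤ K) := by
  -- one translated square through each label of class `k`, written as `e_ψ + (rest supported in class ≤ k − 1)`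
  have hF : ∀ ψ : Ty A, clsTy A ψ = k → ∃ v : Ty A → ℤ, v ∈ spanFaces A ((squares A).filter fun f => wt A f.1 ≤ K) ∧
      ∃ w : Ty A → ℤ, (∀ χ, k ≤ clsTy A χ → w χ = 0) ∧ v = Pi.single ψ 1 + w := by
    intro ψ hψ
    obtain ⟨v, hv, c₂, c₃, c₄, h₂, h₃, h₄, rfl⟩ :=
      exists_square_through_cls A (K := K) (ψ := ψ) (by omega) (by omega)
    refine ⟨_, hv, Pi.single c₂ 1 + Pi.single c₃ 1 + Pi.single c₄ 1, fun χ hχ => ?_, by abel⟩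
    have n2 : χ ≠ c₂ := by rintro rfl; omega
    have n3 : χ ≠ c₃ := by rintro rfl; omega
    have n4 : χ ≠ c₄ := by rintro rfl; omega
    simp only [Pi.add_apply, Pi.single_apply, if_neg n2, if_neg n3, if_neg n4, add_zero]
  choose! F hFmem W hW hFeq using hF
  set L : Finset (Ty A) := univ.filter fun ψ => clsTy A ψ = k with hL
  set q : Ty A → ℤ := ∑ ψ ∈ L, m ψ • F ψ with hq
  have hqmem : q ∈ spanFaces A ((squares A).filter fun f => wt A f.1 ≤ K) :=
    Submodule.sum_mem _ fun ψ hψ => Submodule.smul_mem _ _ (hFmem ψ (Finset.mem_filter.mp hψ).2)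
  -- values of `q` on labels of class `≥ k`
  have hqval : ∀ χ : Ty A, k ≤ clsTy A χ → q χ = if clsTy A χ = k then m χ else 0 := by
    intro χ hχ
    rw [hq, Finset.sum_apply]
    have hterm : ∀ ψ ∈ L, (m ψ • F ψ) χ = if χ = ψ then m ψ else 0 := by
      intro ψ hψ
      have hψk : clsTy A ψ = k := (Finset.mem_filter.mp hψ).2
      rw [Pi.smul_apply, smul_eq_mul, hFeq ψ hψk, Pi.add_apply, hW ψ hψk χ hχ, add_zero, Pi.single_apply]
      split_ifs <;> ring
    rw [Finset.sum_congr rfl hterm, Finset.sum_ite_eq]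
    have hLmem : χ ∈ L ↔ clsTy A χ = k := by rw [hL]; simp
    by_cases hχk : clsTy A χ = k
    · rw [if_pos (hLmem.mpr hχk), if_pos hχk]
    · rw [if_neg (fun h => hχk (hLmem.mp h)), if_neg hχk]
  refine ⟨m - q, ?_, ?_⟩
  · intro χ hχ
    by_contra hc
    apply hχ
    have hk : k ≤ clsTy A χ := by omega
    rw [Pi.sub_apply, hqval χ hk]
    by_cases hχk : clsTy A χ = k
    · rw [if_pos hχk, sub_self]
    · rw [if_neg hχk, sub_zero]
      by_contra hne
      exact hχk (le_antisymm (hm χ hne) hk)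
  · have : m - (m - q) = q := by abel
    rw [this]
    exact hqmem

/-- **Descent by defect class.**  A vector supported in class `≤ K` is congruent, modulo the translates of the canonical squares of
weight `≤ K`, to a vector supported in class `≤ 1`. [folklore] -/
theorem descent_cls (K : ℕ) (m : Ty A → ℤ) (hm : ∀ χ, m χ ≠ 0 → clsTy A χ ≤ K) :
    ∃ r : Ty A → ℤ, (∀ χ, r χ ≠ 0 → clsTy A χ ≤ 1) ∧
      m - r ∈ spanFaces A ((squares A).filter fun f => wt A f.1 ≤ K) := by
  -- induction on an auxiliary bound `k ≤ K`
  suffices h : ∀ k, k ≤ K → ∀ m : Ty A → ℤ, (∀ χ, m χ ≠ 0 → clsTy A χ ≤ k) →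
      ∃ r : Ty A → ℤ, (∀ χ, r χ ≠ 0 → clsTy A χ ≤ 1) ∧ m - r ∈ spanFaces A ((squares A).filter fun f => wt A f.1 ≤ K) from
    h K le_rfl m hm
  intro k
  induction k with
  | zero =>
    intro _ m hm
    exact ⟨m, fun χ h => (hm χ h).trans (Nat.zero_le 1), by rw [sub_self]; exact Submodule.zero_mem _⟩
  | succ k ih =>
    intro hk m hm
    by_cases hk1 : k + 1 ≤ 1
    · exact ⟨m, fun χ h => (hm χ h).trans hk1, by rw [sub_self]; exact Submodule.zero_mem _⟩
    · obtain ⟨m', hm', hdiff⟩ := clear_step_cls A (K := K) (k := k + 1) (by omega) hk m hm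
      obtain ⟨r, hr, hdiff'⟩ := ih (by omega) m' (fun χ h => by have := hm' χ h; omega)
      refine ⟨r, hr, ?_⟩
      have : m - r = (m - m') + (m' - r) := by abel
      rw [this]
      exact Submodule.add_mem _ hdiff hdiff'

/-! ## §4 Folding the heavy labels of class `≤ 1` modulo pairs; the parity-free `exists_reduced` -/

omit [AddCommGroup A] in
/-- **Folding.**  A vector supported in class `≤ 1` is congruent modulo pairs to a vector supported in weight `≤ 1` (move the
coefficient of each label of weight `≥ |A| − 1 > 1` onto its conjugate). [folklore] -/
theorem fold_cls_le_one (r : Ty A → ℤ) (hr : ∀ χ, r χ ≠ 0 → clsTy A χ ≤ 1) :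
    ∃ r' : Ty A → ℤ, (∀ χ, r' χ ≠ 0 → wt A χ ≤ 1) ∧ r - r' ∈ pairs A := by
  set Hv : Finset (Ty A) := univ.filter fun χ => ¬ wt A χ ≤ 1 with hHv
  refine ⟨r - ∑ χ ∈ Hv, r χ • pairVec A χ, ?_, ?_⟩
  · intro χ hχ
    by_contra hw
    apply hχ
    rw [Pi.sub_apply, Finset.sum_apply]
    have hterm : ∀ ψ ∈ Hv, (r ψ • pairVec A ψ) χ = (if χ = ψ then r ψ else 0) + (if χ + 1 = ψ then r ψ else 0) := by
      intro ψ _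
      have hc : (χ = ψ + 1) ↔ (χ + 1 = ψ) := by
        constructor
        · intro h; rw [h, add_one_add_one]
        · intro h; rw [← h, add_one_add_one]
      simp only [pairVec, Pi.smul_apply, Pi.add_apply, smul_eq_mul, Pi.single_apply, hc]
      split_ifs <;> ring
    rw [Finset.sum_congr rfl hterm, Finset.sum_add_distrib, Finset.sum_ite_eq, Finset.sum_ite_eq]
    have hχH : χ ∈ Hv := by rw [hHv]; exact Finset.mem_filter.mpr ⟨Finset.mem_univ _, hw⟩
    rw [if_pos hχH]
    -- the conjugate `χ + 1` is light unless `r (χ + 1) = 0`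
    by_cases hH1 : χ + 1 ∈ Hv
    · rw [if_pos hH1]
      have hw1 : ¬ wt A (χ + 1) ≤ 1 := by rw [hHv] at hH1; exact (Finset.mem_filter.mp hH1).2
      have hr1 : r (χ + 1) = 0 := by
        by_contra hne
        have hc1 := hr _ hne
        unfold clsTy at hc1
        rw [wt_add_one] at hc1 hw1
        have := wt_le A χ
        omega
      rw [hr1]; ring
    · rw [if_neg hH1]; ring
  · have : r - (r - ∑ χ ∈ Hv, r χ • pairVec A χ) = ∑ χ ∈ Hv, r χ • pairVec A χ := by abel
    rw [this]
    exact Submodule.sum_mem _ fun χ _ => Submodule.smul_mem _ _ (Submodule.subset_span ⟨χ, rfl⟩)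

/-- **Reduction with a class bound.**  A vector supported in class `≤ K` is congruent, modulo `pairs ⊔` the translates of the
canonical squares of weight `≤ K`, to a vector supported on the labels of weight `≤ 1`. [folklore] -/
theorem exists_reduced_cls (K : ℕ) (m : Ty A → ℤ) (hm : ∀ χ, m χ ≠ 0 → clsTy A χ ≤ K) :
    ∃ r : Ty A → ℤ, (∀ χ, r χ ≠ 0 → wt A χ ≤ 1) ∧
      m - r ∈ pairs A ⊔ spanFaces A ((squares A).filter fun f => wt A f.1 ≤ K) := by
  obtain ⟨r₁, hr₁, hdiff₁⟩ := descent_cls A K m hm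
  obtain ⟨r, hr, hdiff⟩ := fold_cls_le_one A r₁ hr₁
  refine ⟨r, hr, ?_⟩
  have : m - r = (r₁ - r) + (m - r₁) := by abel
  rw [this]
  exact Submodule.add_mem _ (Submodule.mem_sup_left hdiff) (Submodule.mem_sup_right hdiff₁)

/-- With the trivial bound `K = |A|` the filtered family is the whole family of canonical squares. [folklore] -/
theorem squares_filter_card : ((squares A).filter fun f => wt A f.1 ≤ Fintype.card A) = squares A :=
  Finset.filter_true_of_mem fun f _ => wt_le A f.1

/-- **Every exponent vector is, modulo pairs and translates of canonical squares, supported on the labels of weight `≤ 1`** — for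
EVERY finite abelian group `A` (b09's `OddSliceFacesDescent.exists_reduced` without the hypothesis `Odd (Fintype.card A)`).
[folklore] -/
theorem exists_reduced (m : Ty A → ℤ) :
    ∃ r : Ty A → ℤ, (∀ χ, r χ ≠ 0 → wt A χ ≤ 1) ∧ m - r ∈ pairs A ⊔ spanFaces A (squares A) := by
  have h := exists_reduced_cls A (Fintype.card A) m (fun χ _ => (clsTy_le_wt A χ).trans (wt_le A χ))
  rwa [squares_filter_card] at h

/-! ## §5 Modulo pairs and canonical squares the Hodge lattice is generated by the Weil vector — every finite abelian `A` -/

/-- `pairs ⊔ spanFaces squares ≤ H`. [folklore] -/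
theorem pairs_sup_spanFaces_squares_le_hodge : pairs A ⊔ spanFaces A (squares A) ≤ hodge A :=
  sup_le (pairs_le_hodge A) (spanFaces_le_hodge A fun _ hf => squares_places A hf)

/-- **A Hodge vector is, modulo pairs and translates of canonical squares, an integer multiple of the Weil vector** — for EVERY
finite abelian group `A`. [folklore] -/
theorem exists_sub_smul_weil_mem {m : Ty A → ℤ} (hm : m ∈ hodge A) :
    ∃ ρ : ℤ, m - ρ • weil A ∈ pairs A ⊔ spanFaces A (squares A) := by
  obtain ⟨r, hr, hdiff⟩ := exists_reduced A m
  have hrH : r ∈ hodge A := by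
    have : r = m - (m - r) := by abel
    rw [this]; exact Submodule.sub_mem _ hm (pairs_sup_spanFaces_squares_le_hodge A hdiff)
  refine ⟨r (δ A 0), ?_⟩
  rw [← eq_smul_weil_of_wt_le_one A r hrH hr]
  exact hdiff

/-- **THE PARITY-FREE REDUCTION.**  For every finite abelian group `A`, the Hodge lattice of the faithful full slice of
`(ℤ/2 × A, (1,0))` is contained in `pairs ⊔ ℤ[G]·(canonical squares) ⊔ ℤ·weil`: modulo the divisor pairs and the Galois translates
of the canonical squares (one rank-four face per simple factor of defect class `≥ 2`), the Hodge lattice is cyclic, generated by the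
Weil vector of `E^{|A|−2} × B₁`.  (For `|A|` odd the last summand is needed and is supplied by ONE closing face — b09's
`OddSliceFacesGenerate`; for `|A|` even it is redundant — part F2.) [folklore] -/
theorem hodge_le_pairs_sup_spanFaces_squares_sup_span_weil :
    hodge A ≤ (pairs A ⊔ spanFaces A (squares A)) ⊔ Submodule.span ℤ {weil A} := by
  intro m hm
  obtain ⟨ρ, hρ⟩ := exists_sub_smul_weil_mem A hm
  have : m = (m - ρ • weil A) + ρ • weil A := by abel
  rw [this]
  exact Submodule.add_mem _ (Submodule.mem_sup_left hρ)
    (Submodule.mem_sup_right (Submodule.smul_mem _ _ (Submodule.subset_span rfl)))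

end Summit.HodgeConjecture.CorCM.Census.EvenSliceFacesDescent
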